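import Summits.Ventures.LatticeQCDFlow.Scaling.SimulatedTemperingFiniteSampler
import Literature.Probability.MarkovChains.MetropolisHastings

/-!
HONEST FRAMING: exact (Metropolis-corrected) sampling algorithms for lattice gauge theory; figures
of merit are autocorrelation/cost numbers at stated couplings and volumes; no continuum-physics
claim.

# SimulatedTemperingFlowSampler — SIMULATED TEMPERING WITH TRANSPORT MAPS ON A FINITE CONFIGURATION SPACE: MOVING UP
# THE LADDER FROM LEVEL `j` TO `j+1` THE CONFIGURATION IS MAPPED BY A BIJECTION `φ_j`, MOVING DOWN BY `φ_j⁻¹`, AND THE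
# MOVE IS METROPOLIS-CORRECTED AGAINST THE EXACT-WEIGHT TARGET `π(k,x) = μ_k(x)/(K+1)`; THE PROPOSAL IS SYMMETRIC, THE
# SAMPLER IS EXACT (DETAILED BALANCE) (lean-2 GEN-19, ours)

Venture-side (OURS).  Cell `lqcd-flow` (pub-lqcd), unit `pub-lqcd-lean-2-g19`, 2026-08-25.  The simulated-tempering
companion of `Scaling/ReplicaExchangeFlowSwap`, in the setting of `Scaling/SimulatedTemperingFiniteSampler`
(GEN-16: levels `k : Fin (K+1)`, positive level laws `μ_k`, within-level updates `M_k`, state `(k, x)`, target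
`stFinLaw μ`).  Motivation (value-free): deterministic transport layers between neighbouring levels of an annealing
or tempering ladder (learned maps pushing `μ_j` towards `μ_{j+1}`) are the reversible-chain relative of stochastic
normalizing flows; on a finite configuration space such a layer is a bijection `φ_j : S ≃ S`.  Objects (defs):
`stFlowProposal φ` — from `(j, x)` propose `(j+1, φ_j x)` with probability `½`, from `(j+1, x)` propose
`(j, φ_j⁻¹ x)` with probability `½`; `stFlowLevel μ φ = mhKernel (stFlowProposal φ) (stFinLaw μ)` (accept with
`min{1, μ_{j+1}(φ_j x)/μ_j(x)}` upwards); `stFlowSampler t μ M φ = t·stFlowLevel μ φ + (1−t)·stFinWithin M`.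

## What is proved

* §1 `stFlowProposal_symm` (the up-move from `(j,x)` and the down-move from `(j+1, φ_j x)` are each other's
  reverses), `stFlowProposal_nonneg`, `sum_stFlowProposal_le_one`, `stFlowProposal_up_eq` / `_down_eq` (each
  available move is proposed with probability exactly `½`).
* §2 `stFlowLevel`, `stFlowSampler`: ROW-STOCHASTIC and in **DETAILED BALANCE** with `stFinLaw μ` (`0 ≤ t ≤ 1`,
  `μ_k > 0`, `M_k` row-stochastic and `μ_k`-reversible); the off-diagonal flow formula
  `π(p)·FL(p,q) = T(p,q)·min{π(p), π(q)}`; **`stFlowLevel_eq_zero_of_not_image`** — a level move from `(k,x)` only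
  reaches states whose configuration is `φ_j x` (one level up) or `φ_j⁻¹ x` (one level down).

NOT CLAIMED: rates (the sequel shows that SECTOR-PRESERVING maps leave the torpid ceiling of
`Scaling/SimulatedTemperingModeTorpid` in force); continuous spaces; how the maps are trained; anything measured.
Literature grade (cell rule): KNOWN ALGORITHM CLASS (tempering / annealing with deterministic transport moves,
Metropolis-corrected), NEW TYPING; nothing cited as a fact; no new bib keys.
-/

noncomputable section

open Finset Function
open Literature.Probability.MarkovChains

namespace Summit.Ventures.LatticeQCDFlow.Scaling

variable {S : Type*} [Fintype S] [DecidableEq S] {K : ℕ}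

/-! ## §1 The transport proposal -/

/-- The transport proposal: from `(j, x)` go to `(j+1, φ_j x)` with probability `½`; from `(j+1, x)` go to
`(j, φ_j⁻¹ x)` with probability `½`. [ours] -/
def stFlowProposal (φ : Fin K → Equiv.Perm S) (p q : Fin (K + 1) × S) : ℝ :=
  ∑ j : Fin K, ((if p.1 = j.castSucc ∧ q = (j.succ, φ j p.2) then (1 : ℝ) / 2 else 0)
    + (if p.1 = j.succ ∧ q = (j.castSucc, (φ j).symm p.2) then (1 : ℝ) / 2 else 0))

omit [Fintype S] [DecidableEq S] in
/-- The up-move from `p` to `q` is the down-move from `q` to `p` read backwards. [ours] -/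
theorem stFlow_up_iff_down (φ : Fin K → Equiv.Perm S) (j : Fin K) (p q : Fin (K + 1) × S) :
    (p.1 = j.castSucc ∧ q = (j.succ, φ j p.2)) ↔ (q.1 = j.succ ∧ p = (j.castSucc, (φ j).symm q.2)) := by
  constructor
  · rintro ⟨hp, hq⟩
    refine ⟨by rw [hq], ?_⟩
    rw [hq]
    simp only [Equiv.symm_apply_apply]
    exact Prod.ext hp rfl
  · rintro ⟨hq, hp⟩
    refine ⟨by rw [hp], ?_⟩
    rw [hp]
    simp only [Equiv.apply_symm_apply]
    exact Prod.ext hq rfl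

omit [Fintype S] in
/-- The proposal is symmetric. [ours] -/
theorem stFlowProposal_symm (φ : Fin K → Equiv.Perm S) (p q : Fin (K + 1) × S) :
    stFlowProposal φ p q = stFlowProposal φ q p := by
  unfold stFlowProposal
  refine sum_congr rfl fun j _ => ?_
  rw [if_congr (stFlow_up_iff_down φ j p q) rfl rfl, ← if_congr (stFlow_up_iff_down φ j q p) rfl rfl, add_comm]

omit [Fintype S] in
/-- The proposal is non-negative. [ours] -/
theorem stFlowProposal_nonneg (φ : Fin K → Equiv.Perm S) (p q : Fin (K + 1) × S) : 0 ≤ stFlowProposal φ p q :=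
  sum_nonneg fun j _ => add_nonneg (by split_ifs <;> norm_num) (by split_ifs <;> norm_num)

/-- The proposal has row mass `≤ 1` (at most one level up, at most one level down). [ours] -/
theorem sum_stFlowProposal_le_one (φ : Fin K → Equiv.Perm S) (p : Fin (K + 1) × S) :
    ∑ q, stFlowProposal φ p q ≤ 1 := by
  unfold stFlowProposal
  rw [Finset.sum_comm]
  simp_rw [Finset.sum_add_distrib, ite_and]
  have hup : ∀ j : Fin K, ∑ q : Fin (K + 1) × S,
      (if p.1 = j.castSucc then (if q = (j.succ, φ j p.2) then (1 : ℝ) / 2 else 0) else 0)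
        = if p.1 = j.castSucc then 1 / 2 else 0 := by
    intro j
    split_ifs with h
    · rw [Finset.sum_ite_eq' univ (j.succ, φ j p.2), if_pos (mem_univ _)]
    · simp
  have hdown : ∀ j : Fin K, ∑ q : Fin (K + 1) × S,
      (if p.1 = j.succ then (if q = (j.castSucc, (φ j).symm p.2) then (1 : ℝ) / 2 else 0) else 0)
        = if p.1 = j.succ then 1 / 2 else 0 := by
    intro j
    split_ifs with h
    · rw [Finset.sum_ite_eq' univ (j.castSucc, (φ j).symm p.2), if_pos (mem_univ _)]
    · simp
  simp_rw [hup, hdown]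
  -- at most one `j` with `j.castSucc = p.1`, at most one with `j.succ = p.1`
  have h1 : ∑ j : Fin K, (if p.1 = j.castSucc then (1 : ℝ) / 2 else 0) ≤ 1 / 2 := by
    by_cases hp : ∃ j : Fin K, p.1 = j.castSucc
    · obtain ⟨j₀, hj₀⟩ := hp
      rw [Finset.sum_eq_single j₀ (fun j _ hj => if_neg fun h => hj (Fin.castSucc_injective _ (h.symm.trans hj₀).symm).symm)
        (fun h => absurd (mem_univ _) h), if_pos hj₀]
    · push Not at hp
      rw [Finset.sum_eq_zero fun j _ => if_neg (hp j)]; norm_num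
  have h2 : ∑ j : Fin K, (if p.1 = j.succ then (1 : ℝ) / 2 else 0) ≤ 1 / 2 := by
    by_cases hp : ∃ j : Fin K, p.1 = j.succ
    · obtain ⟨j₀, hj₀⟩ := hp
      rw [Finset.sum_eq_single j₀ (fun j _ hj => if_neg fun h => hj (Fin.succ_injective _ (h.symm.trans hj₀).symm).symm)
        (fun h => absurd (mem_univ _) h), if_pos hj₀]
    · push Not at hp
      rw [Finset.sum_eq_zero fun j _ => if_neg (hp j)]; norm_num
  linarith

omit [Fintype S] in
/-- The up-move `(j, x) → (j+1, φ_j x)` is proposed with probability exactly `½`. [ours] -/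
theorem stFlowProposal_up_eq (φ : Fin K → Equiv.Perm S) (j : Fin K) (x : S) :
    stFlowProposal φ (j.castSucc, x) (j.succ, φ j x) = 1 / 2 := by
  have hne : j.castSucc ≠ j.succ := ne_of_lt Fin.castSucc_lt_succ
  unfold stFlowProposal
  rw [Finset.sum_eq_single j]
  · have hdown : ¬(((j.castSucc, x) : Fin (K + 1) × S).1 = j.succ
        ∧ ((j.succ, φ j x) : Fin (K + 1) × S) = (j.castSucc, (φ j).symm ((j.castSucc, x) : Fin (K + 1) × S).2)) :=
      fun h => hne h.1
    rw [if_pos ⟨rfl, rfl⟩, if_neg hdown, add_zero]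
  · intro i _ hij
    have hup : ¬(((j.castSucc, x) : Fin (K + 1) × S).1 = i.castSucc
        ∧ ((j.succ, φ j x) : Fin (K + 1) × S) = (i.succ, φ i ((j.castSucc, x) : Fin (K + 1) × S).2)) :=
      fun h => hij (Fin.castSucc_injective _ h.1).symm
    have hdown : ¬(((j.castSucc, x) : Fin (K + 1) × S).1 = i.succ
        ∧ ((j.succ, φ j x) : Fin (K + 1) × S) = (i.castSucc, (φ i).symm ((j.castSucc, x) : Fin (K + 1) × S).2)) := by
      rintro ⟨h1, h2⟩
      have e1 := congrArg Fin.val (h1 : j.castSucc = i.succ)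
      have e2 := congrArg Fin.val (congrArg Prod.fst h2 : j.succ = i.castSucc)
      simp only [Fin.val_castSucc, Fin.val_succ] at e1 e2
      omega
    rw [if_neg hup, if_neg hdown, add_zero]
  · intro h; exact absurd (mem_univ j) h

omit [Fintype S] in
/-- The down-move `(j+1, x) → (j, φ_j⁻¹ x)` is proposed with probability exactly `½`. [ours] -/
theorem stFlowProposal_down_eq (φ : Fin K → Equiv.Perm S) (j : Fin K) (x : S) :
    stFlowProposal φ (j.succ, x) (j.castSucc, (φ j).symm x) = 1 / 2 := by
  rw [stFlowProposal_symm]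
  have h := stFlowProposal_up_eq φ j ((φ j).symm x)
  rwa [Equiv.apply_symm_apply] at h

/-! ## §2 The Metropolis transport move and the sampler -/

/-- THE METROPOLIS TRANSPORT LEVEL MOVE: `mhKernel` of the transport proposal for the exact-weight target. [ours] -/
def stFlowLevel (μ : Fin (K + 1) → S → ℝ) (φ : Fin K → Equiv.Perm S) :
    Matrix (Fin (K + 1) × S) (Fin (K + 1) × S) ℝ :=
  mhKernel (stFlowProposal φ) (stFinLaw μ)

/-- THE SIMULATED-TEMPERING SAMPLER WITH TRANSPORT MAPS: with probability `t` a Metropolis transport level move, with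
probability `1 − t` a within-level update. [ours] -/
def stFlowSampler (t : ℝ) (μ : Fin (K + 1) → S → ℝ) (M : Fin (K + 1) → Matrix S S ℝ) (φ : Fin K → Equiv.Perm S) :
    Matrix (Fin (K + 1) × S) (Fin (K + 1) × S) ℝ :=
  Matrix.of fun p q => t * stFlowLevel μ φ p q + (1 - t) * stFinWithin M p q

section Basic

variable {μ : Fin (K + 1) → S → ℝ} {M : Fin (K + 1) → Matrix S S ℝ} {t : ℝ} {φ : Fin K → Equiv.Perm S}

/-- The transport level move is in detailed balance with the target. [ours] -/
theorem stFlowLevel_detailedBalance (hμ : ∀ k x, 0 < μ k x) : DetailedBalance (stFinLaw μ) (stFlowLevel μ φ) :=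
  mhKernel_detailedBalance (stFinLaw_pos hμ) _

/-- The transport level move is a transition matrix. [ours] -/
theorem stFlowLevel_isRowStochastic (hμ : ∀ k x, 0 < μ k x) : IsRowStochastic (stFlowLevel μ φ) :=
  ⟨mhKernel_nonneg (stFlowProposal_nonneg φ) (sum_stFlowProposal_le_one φ) (stFinLaw_pos hμ),
    mhKernel_sum_eq_one _ _⟩

/-- Off the diagonal, `π(p)·FL(p,q) = T(p,q)·min{π(p), π(q)}`. [ours] -/
theorem stFinLaw_mul_stFlowLevel (hμ : ∀ k x, 0 < μ k x) {p q : Fin (K + 1) × S} (hqp : q ≠ p) :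
    stFinLaw μ p * stFlowLevel μ φ p q = stFlowProposal φ p q * min (stFinLaw μ p) (stFinLaw μ q) := by
  unfold stFlowLevel
  rw [mhKernel_of_ne hqp, mul_mhRate (stFinLaw_pos hμ), stFlowProposal_symm φ q p,
    ← min_mul_of_nonneg _ _ (stFlowProposal_nonneg φ p q), mul_comm]

omit [Fintype S] in
/-- The proposal vanishes unless the new configuration is a transport image of the old one. [ours] -/
theorem stFlowProposal_eq_zero_of_not_image {p q : Fin (K + 1) × S}
    (hup : ∀ j : Fin K, p.1 = j.castSucc → q ≠ (j.succ, φ j p.2))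
    (hdown : ∀ j : Fin K, p.1 = j.succ → q ≠ (j.castSucc, (φ j).symm p.2)) :
    stFlowProposal φ p q = 0 := by
  unfold stFlowProposal
  refine Finset.sum_eq_zero fun j _ => ?_
  rw [if_neg (fun h => hup j h.1 h.2), if_neg (fun h => hdown j h.1 h.2), add_zero]

/-- **A transport level move only reaches transport images:** `FL(p,q) = 0` for `q ≠ p` unless `q = (j+1, φ_j p.2)`
with `p.1 = j` or `q = (j, φ_j⁻¹ p.2)` with `p.1 = j+1`. [ours] -/
theorem stFlowLevel_eq_zero_of_not_image (hμ : ∀ k x, 0 < μ k x) {p q : Fin (K + 1) × S} (hqp : q ≠ p)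
    (hup : ∀ j : Fin K, p.1 = j.castSucc → q ≠ (j.succ, φ j p.2))
    (hdown : ∀ j : Fin K, p.1 = j.succ → q ≠ (j.castSucc, (φ j).symm p.2)) :
    stFlowLevel μ φ p q = 0 := by
  have h := stFinLaw_mul_stFlowLevel (φ := φ) hμ hqp
  rw [stFlowProposal_eq_zero_of_not_image hup hdown, zero_mul] at h
  exact (mul_eq_zero.mp h).resolve_left (stFinLaw_pos hμ p).ne'

/-- Entries of the sampler. [ours] -/
theorem stFlowSampler_apply (t : ℝ) (μ : Fin (K + 1) → S → ℝ) (M : Fin (K + 1) → Matrix S S ℝ)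
    (φ : Fin K → Equiv.Perm S) (p q : Fin (K + 1) × S) :
    stFlowSampler t μ M φ p q = t * stFlowLevel μ φ p q + (1 - t) * stFinWithin M p q := rfl

/-- The sampler is a transition matrix (`0 ≤ t ≤ 1`). [ours] -/
theorem stFlowSampler_isRowStochastic (hμ : ∀ k x, 0 < μ k x) (hM : ∀ k, IsRowStochastic (M k))
    (ht0 : 0 ≤ t) (ht1 : t ≤ 1) : IsRowStochastic (stFlowSampler t μ M φ) := by
  refine ⟨fun p q => ?_, fun p => ?_⟩
  · rw [stFlowSampler_apply]
    exact add_nonneg (mul_nonneg ht0 ((stFlowLevel_isRowStochastic (φ := φ) hμ).1 p q))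
      (mul_nonneg (by linarith) ((stFinWithin_isRowStochastic hM).1 p q))
  · simp_rw [stFlowSampler_apply]
    rw [Finset.sum_add_distrib, ← Finset.mul_sum, ← Finset.mul_sum, (stFlowLevel_isRowStochastic (φ := φ) hμ).2 p,
      (stFinWithin_isRowStochastic hM).2 p]
    ring

/-- **The sampler is in DETAILED BALANCE with the target** — tempering with transport maps is exact. [ours] -/
theorem stFlowSampler_detailedBalance (hμ : ∀ k x, 0 < μ k x) (hMrev : ∀ k, DetailedBalance (μ k) (M k)) :
    DetailedBalance (stFinLaw μ) (stFlowSampler t μ M φ) := by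
  intro p q
  rw [stFlowSampler_apply, stFlowSampler_apply]
  have h1 := stFlowLevel_detailedBalance (φ := φ) hμ p q
  have h2 := stFinWithin_detailedBalance hMrev p q
  calc stFinLaw μ p * (t * stFlowLevel μ φ p q + (1 - t) * stFinWithin M p q)
      = t * (stFinLaw μ p * stFlowLevel μ φ p q) + (1 - t) * (stFinLaw μ p * stFinWithin M p q) := by ring
    _ = t * (stFinLaw μ q * stFlowLevel μ φ q p) + (1 - t) * (stFinLaw μ q * stFinWithin M q p) := by
        rw [h1, h2]
    _ = stFinLaw μ q * (t * stFlowLevel μ φ q p + (1 - t) * stFinWithin M q p) := by ring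

/-- The target is stationary for the sampler. [ours] -/
theorem stFlowSampler_isStationary (hμ : ∀ k x, 0 < μ k x) (hM : ∀ k, IsRowStochastic (M k))
    (hMrev : ∀ k, DetailedBalance (μ k) (M k)) (ht0 : 0 ≤ t) (ht1 : t ≤ 1) :
    IsStationary (stFinLaw μ) (stFlowSampler t μ M φ) :=
  (stFlowSampler_detailedBalance hμ hMrev).isStationary (stFlowSampler_isRowStochastic hμ hM ht0 ht1).2

end Basic

end Summit.Ventures.LatticeQCDFlow.Scaling

end
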